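import Literature.AlgebraicGeometry.Frobenioids.Thm36SubRlfCompletion
import Literature.AlgebraicGeometry.Frobenioids.Thm36SubProofs
import Literature.AlgebraicGeometry.Frobenioids.Thm36SubProofs3
import Literature.AlgebraicGeometry.Frobenioids.Thm36SubIstrTypesQ
import Literature.AlgebraicGeometry.Frobenioids.Thm36SubAutActionQ
import Literature.AlgebraicGeometry.Frobenioids.Thm36SubAutActionR
import Literature.AlgebraicGeometry.Frobenioids.Thm36SubPerfectionUnitsQ
import Literature.AlgebraicGeometry.Frobenioids.Thm36SubReadingsQ
import Literature.AlgebraicGeometry.Frobenioids.ArchimedeanThm36viInstances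
import Literature.AlgebraicGeometry.Frobenioids.ArchimedeanUnitGroupsAngular
import Literature.AlgebraicGeometry.Frobenioids.ArchimedeanAutActionReadings
import Literature.AlgebraicGeometry.Frobenioids.ArchimedeanDissectionProofs
import HarnessLib

/-!
# Frobenioids II, Theorem 3.6 for `C^Λ`, ALL `Λ ∈ {ℤ, ℚ, ℝ}`: the instance statements DISCHARGED — part A
# ((i) «istr» clauses, (iv), (v), (vi), (viii))

Mochizuki, *The geometry of Frobenioids II*, Kyushu J. Math. **62** (2008) 401–460, Theorem 3.6 pp. 36–38,
for the archimedean Frobenioids `C^ℤ := C`, `C^ℚ := C^pf`, `C^ℝ := C^rlf` of Example 3.3 (ii) p. 28.  The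
typer's `Λ`-indexed instance statements (`ArchimedeanTheoremsInstances.lean`, seat abc-iut-L1-t9) are
parametrised by completion data `pf rlf : LambdaCompletion π`; at THE data
`(pf, rlf) := (Thm36Sub.pfCompletion π hF, Thm36Sub.rlfCompletion π)` (THE perfection of [FrdI] Def. 3.1
(iii) and THE realification of [FrdI] Prop. 5.3) their three conjuncts are, definitionally, the landed
`Λ = ℤ` theorems (seats t6 / t9 / d103 / d027 / L6-d7 …) and the `…_Q` / `…_R` slots of `Thm36Sub.lean`
(abc-iut cell, L1 row M13), all of which are now closed in the tree (seats w4-d074, w5-d161, w5-d190, w5-d237,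
L1-d5, w5-d036).  This PROOF-ONLY file (part A) assembles BY NAME: Thm. 3.6 (i) [«(C^Λ)^istr isotropic, base-trivial»,
«Λ ≥ ℚ ⇒ (C^Λ)^istr = C^Λ»], (iv) first sentence, (v), (vi); (viii) and the (iv) readings are already
closed for every `rlf` (`ArchFrd.thm36viii_CA_holds`, `Thm36Sub.thm36iv_readings_CA_pfCompletion`) and
are re-exported here at THE data for convenience.  Part B (`Thm36SubInstancesB.lean`: (i) typology,
(ix), (x)) is a separate file only because its three inputs `Thm36SubAmpleTypesQ` / `Thm36SubIndissectR` /
`Thm36SubSlim` had no farm olean when this part was filed.  The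
standing hypothesis `hF : IsFrobenioid (C → F_Φ)` ("`C` is a Frobenioid", Ex. 3.3 (ii); it carries
"`D` connected") is the parameter of THE perfection.  No side taken on [IUTchIII] Cor. 3.12.
-/

noncomputable section

namespace Literature.AlgebraicGeometry.Frobenioids

open CategoryTheory Opposite

universe v u

namespace ArchFrd

namespace Thm36Sub

variable {D : Type u} [Category.{v} D] (π : D ⥤ D0)

/-- **Thm. 3.6 (i)** "If `Λ ≥ ℚ`, then `(C^Λ)^istr = C^Λ`" — t9's instance `Thm36i_istr_all_C` DISCHARGED at
THE data (`Λ = ℤ` vacuous; `istrAll_Q_holds`; `istrAll_R_holds`). [cite: MochizukiFrdII2008, Thm 3.6 (i) p.36] -/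
theorem thm36i_istr_all_C_holds (hF : PreFrobenioid.IsFrobenioid (C.toElem π)) :
    Literature.AlgebraicGeometry.Frobenioids.ArchFrd.Thm36i_istr_all_C π (pfCompletion π hF)
      (rlfCompletion π) := by
  intro Λ
  cases Λ with
  | Z => exact fun h => absurd rfl h
  | Q => exact istrAll_Q_holds π hF
  | R => exact istrAll_R_holds π

/-- **Thm. 3.6 (i)** "`(C^Λ)^istr` is of isotropic, base-trivial type" — t9's instance `Thm36i_istrTypes_C`
DISCHARGED at THE data (`thm36i_istrTypes_C'`, seat t6; `istrTypes_Q_holds`, seat w5-d161; `istrTypes_R_holds`).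
[cite: MochizukiFrdII2008, Thm 3.6 (i) p.36] -/
theorem thm36i_istrTypes_C_holds (hF : PreFrobenioid.IsFrobenioid (C.toElem π)) :
    Literature.AlgebraicGeometry.Frobenioids.ArchFrd.Thm36i_istrTypes_C π (pfCompletion π hF)
      (rlfCompletion π) := by
  intro Λ
  cases Λ with
  | Z => exact thm36i_istrTypes_C' π
  | Q => exact istrTypes_Q_holds π hF
  | R => exact istrTypes_R_holds π

/-- **Thm. 3.6 (iv)**, first sentence ("the natural action of `Aut_F(A)` on `O^▷(A), O^×(A)` factors through
`Aut_{D₀}(A₀)`") — t9's instance `Thm36iv_C` DISCHARGED at THE data (`thm36iv_factors_C`, seat t9, via d103's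
`thm36iv_C_of_pf_rlf`; `ivFactors_Q_holds`, seat w5-d190; `ivFactors_R_holds`, seat L1-d5).
[cite: MochizukiFrdII2008, Thm 3.6 (iv) p.37] -/
theorem thm36iv_C_holds (hF : PreFrobenioid.IsFrobenioid (C.toElem π)) :
    Literature.AlgebraicGeometry.Frobenioids.ArchFrd.Thm36iv_C π (pfCompletion π hF) (rlfCompletion π) :=
  thm36iv_C_of_pf_rlf π _ _ (ivFactors_Q_holds π hF) (ivFactors_R_holds π)

/-- **Thm. 3.6 (v)** (the structure of `O^×(A)`, all clauses, all `Λ`) — t9's instance `Thm36v_C` DISCHARGED at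
THE data (`Λ = ℤ` by d027's `thm36v_C_iff`; `v_Q_holds`, seat w5-d237; `v_R_holds`).
[cite: MochizukiFrdII2008, Thm 3.6 (v) p.37] -/
theorem thm36v_C_holds (hF : PreFrobenioid.IsFrobenioid (C.toElem π)) :
    Literature.AlgebraicGeometry.Frobenioids.ArchFrd.Thm36v_C π (pfCompletion π hF) (rlfCompletion π) := by
  refine (thm36v_C_iff π _ _).2 fun Λ hΛ => ?_
  cases Λ with
  | Z => exact absurd rfl hΛ
  | Q => exact v_Q_holds π hF
  | R => exact v_R_holds π

/-- **Thm. 3.6 (vi)** ("if `D` admits a pseudo-terminal object, then `F` admits a pseudo-terminal object",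
`F ∈ {C^Λ, A}`) — t9's instance `Thm36vi_CA` DISCHARGED at THE data (d100's `thm36vi_CA_of`; `vi_Q_holds`;
`vi_R_holds`). [cite: MochizukiFrdII2008, Thm 3.6 (vi) p.37] -/
theorem thm36vi_CA_holds (hF : PreFrobenioid.IsFrobenioid (C.toElem π)) :
    Literature.AlgebraicGeometry.Frobenioids.ArchFrd.Thm36vi_CA π (pfCompletion π hF) (rlfCompletion π) :=
  thm36vi_CA_of π _ _ (vi_Q_holds π hF) (vi_R_holds π)

/-- **Thm. 3.6 (viii)** ("if `Λ = ℤ`, then `F[ℂ]` is of weakly dissectible type") — t9's instance `Thm36viii_CA`,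
closed for every datum by d027's `thm36viii_CA_holds`, at THE data. [cite: MochizukiFrdII2008, Thm 3.6 (viii) p.38] -/
theorem thm36viii_CA_holds' (hF : PreFrobenioid.IsFrobenioid (C.toElem π)) :
    Literature.AlgebraicGeometry.Frobenioids.ArchFrd.Thm36viii_CA π (pfCompletion π hF) (rlfCompletion π) :=
  thm36viii_CA_holds π _ _

/-- **Thm. 3.6 (iv)**, second sentence, both repaired readings, for `C^Λ` and `A` — t9's instance
`Thm36iv_readings_CA`, closed for every `rlf` by w5-d237's `thm36iv_readings_CA_pfCompletion`, at THE data.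
[cite: MochizukiFrdII2008, Thm 3.6 (iv) p.37] -/
theorem thm36iv_readings_CA_holds (hF : PreFrobenioid.IsFrobenioid (C.toElem π)) :
    Literature.AlgebraicGeometry.Frobenioids.ArchFrd.Thm36iv_readings_CA π (pfCompletion π hF)
      (rlfCompletion π) :=
  thm36iv_readings_CA_pfCompletion π hF _

end Thm36Sub

end ArchFrd

end Literature.AlgebraicGeometry.Frobenioids
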